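import Mathlib.Analysis.Normed.Unbundled.SpectralNorm
import Mathlib.RingTheory.Valuation.Integral
import Literature.NumberTheory.GaloisRepresentations.LocalGaloisGroup
import Literature.NumberTheory.GaloisRepresentations.ClosureValuation
import HarnessLib

/-!
# The canonical prime of `\bar 𝒪_F` over a complete field: spectral-norm description, and
discharges of the henselian named facts of `LocalGaloisGroup.lean` (trunk GalRep, item C4)

D-0014 keeps `Literature/` sorry-free by stating cited results as named facts `def X : Prop`.
This sibling file proves the *henselian* named facts of
`Literature.NumberTheory.GaloisRepresentations.LocalGaloisGroup` — those about the canonical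
ideal `𝔓 = absMaximalIdeal F = (𝓂[F] S).radical` of `S = absIntegers 𝒪[F] F` (integral closure
of `𝒪[F]` in `F̄`) for a non-archimedean local field `F` which need `F` to be henselian, and which
the sibling file `LocalGaloisGroupProofs` (facts following from the definitions alone) leaves open
— as `theorem X_holds : X`:

* `IsNonarchimedeanLocalField.absMaximalIdeal_isMaximal_holds` (`𝔓` is maximal) and
  `IsNonarchimedeanLocalField.primesOver_maximalIdeal_eq_singleton_holds` (`𝔓` is the only prime
  of `S` over `𝓂[F]`), both from `absMaximalIdeal_isMaximal_and_primesOver_eq`.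

The general section `Spectral` (any complete non-archimedean `F` and any valuation `w` with the
same unit ball as `‖·‖`) is also the input of `GaloisRepUnramifiedProofs` (local–global
compatibility of inertia), through `mem_absIntegers_integer_iff_spectralNorm_le_one` and
`mem_radical_map_maximalIdeal_iff`.
The extra import `Mathlib.Analysis.Normed.Unbundled.SpectralNorm` is the reason for a sibling file.

## The general statement (section `Spectral`)

Let `F` be a field complete for a non-trivial non-archimedean absolute value `‖·‖`, `w` a valuation
on `F` with the same closed unit ball (`w x ≤ 1 ↔ ‖x‖ ≤ 1`; then also `w x < 1 ↔ ‖x‖ < 1`),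
`O = w.integer`, `F̄ = AlgebraicClosure F`, `S = absIntegers O F` and
`𝔓 = ((maximalIdeal O).map (algebraMap O S)).radical`.  Write `|·|_sp` for the spectral norm of
`F̄/F` (Mathlib `spectralNorm F F̄`: `|x|_sp = max ‖a_{n-k}‖^{1/k}` over the coefficients of the
minimal polynomial `X^n + a_{n-1} X^{n-1} + ⋯ + a_0` of `x`; it is the unique absolute value of `F̄`
extending `‖·‖`, Mathlib `spectralNorm_unique`, `spectralMulAlgNorm`).  Then:

* `mem_absIntegers_integer_iff_spectralNorm_le_one`: `x ∈ S ↔ |x|_sp ≤ 1` (`O` is integrally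
  closed, so the minimal polynomial of an `O`-integral element has coefficients in `O`, Mathlib
  `minpoly.isIntegrallyClosed_eq_field_fractions'`; conversely a monic polynomial with
  coefficients of norm `≤ 1` lifts to `O[X]`).  This is the `Valuation.integer` form of
  `Literature.NumberTheory.GaloisRepresentations.mem_absIntegers_iff_spectralNorm_le_one` of `ClosureValuation.lean` (stated there for a
  `ValuationSubring R` with `x ∈ R ↔ ‖x‖ ≤ 1`); the present file needs the `Subring`
  `w.integer`, because `absMaximalIdeal F` lives over `𝒪[F] = (valuation F).integer`, and the two
  subtypes are not syntactically interchangeable in `absIntegers _ F`;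
* `mem_radical_map_maximalIdeal_iff`: `x ∈ 𝔓 ↔ |x|_sp < 1` (the open unit ball is a radical
  ideal of `S` containing `𝓂_O S`; conversely `|x|_sp < 1` forces the lower coefficients of the
  minimal polynomial into `𝓂_O`, whence `x ^ n ∈ 𝓂_O S`);
* hence `𝔓` is maximal (`isMaximal_radical_map_maximalIdeal`: an element of `S ∖ 𝔓` has
  `|x|_sp = 1`, so `x⁻¹ ∈ S`), `Gal(F̄/F)`-stable (`smul_radical_map_maximalIdeal`, as
  `|σ x|_sp = |x|_sp`, `Literature.NumberTheory.GaloisRepresentations.spectralNorm_absoluteGaloisGroup_smul` of `ClosureValuation.lean`,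
  Mathlib `spectralNorm_eq_of_equiv`), lies over `𝓂_O`
  (`under_radical_map_maximalIdeal`) and is the only prime of `S` over `𝓂_O`
  (`primesOver_maximalIdeal_eq_singleton_radical`).

This is the content of Serre, *Local Fields*, Ch. II §2, Prop. 3 and Cor. 2–4 (for `K` complete,
the valuation extends uniquely to every finite extension `L`, conjugate elements have the same
valuation, and `‖x‖_L = ‖N_{L/K} x‖_K^{1/[L:K]}`; the integral closure of the valuation ring is the
valuation ring of the extension), passed to the limit `F̄ = ⋃ L`; the formulation through the
spectral norm is that of Bosch–Güntzer–Remmert, *Non-Archimedean Analysis*, §3.2, followed by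
Mathlib.  For a non-archimedean local field `F` (section `LocalField`) we take `w = valuation F` and
the norm `Valued.toNormedField` attached to it (rank one), as Mathlib does in
`Mathlib/NumberTheory/LocalField/Basic.lean`; `F` is complete (Mathlib instance).

## References

* J.-P. Serre, *Local Fields*, GTM 67, Springer 1979, Ch. II §2, Prop. 3, Cor. 2 (uniqueness of the
  prolongation), Cor. 3 (conjugates have the same valuation), Cor. 4; Ch. II §3 Cor. 4.
  [SerreLocalFields1979]
* J. Neukirch, *Algebraic Number Theory*, Springer 1999, Ch. II (6.2) (henselian fields: the
  valuation ring of the algebraic closure is the integral closure), Ch. II §9. [NeukirchANT1999]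
* J. Tate, *Number theoretic background* (Corvallis 1979), (1.4.1). [Corvallis1979]
-/

noncomputable section

open scoped Pointwise
open Polynomial Field

namespace Literature.NumberTheory.GaloisRepresentations

/-! ### Two elementary facts on spectral values -/

section SpectralValue

variable {R : Type*} [SeminormedRing R]

/-- If all non-leading coefficients of `p` have norm `< 1`, then `spectralValue p < 1`
(the supremum defining the spectral value is attained, the range being finite).  Companion to
Mathlib's `spectralValue_le_one_iff`. [folklore] -/
theorem spectralValue_lt_one_of_norm_coeff_lt_one {p : R[X]}
    (h : ∀ n < p.natDegree, ‖p.coeff n‖ < 1) : spectralValue p < 1 := by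
  have hne : (Set.range (spectralValueTerms p)).Nonempty := Set.range_nonempty _
  obtain ⟨n, hn⟩ := hne.csSup_mem (spectralValueTerms_finite_range p)
  rw [spectralValue, iSup, ← hn]
  by_cases hlt : n < p.natDegree
  · rw [spectralValueTerms_of_lt_natDegree p hlt]
    refine Real.rpow_lt_one (norm_nonneg _) (h n hlt) (one_div_pos.mpr ?_)
    rw [sub_pos]
    exact_mod_cast hlt
  · rw [spectralValueTerms_of_natDegree_le p (not_lt.mp hlt)]
    exact zero_lt_one

/-- If `spectralValue p < 1`, then all non-leading coefficients of `p` have norm `< 1`.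
Companion to Mathlib's `spectralValue_le_one_iff`. [folklore] -/
theorem norm_coeff_lt_one_of_spectralValue_lt_one {p : R[X]} (h : spectralValue p < 1) {n : ℕ}
    (hn : n < p.natDegree) : ‖p.coeff n‖ < 1 := by
  have hle : spectralValueTerms p n ≤ spectralValue p :=
    le_ciSup (spectralValueTerms_bddAbove p) n
  rw [spectralValueTerms_of_lt_natDegree p hn] at hle
  by_contra hc
  have hpos : 0 < 1 / ((p.natDegree : ℝ) - n) :=
    one_div_pos.mpr (by rw [sub_pos]; exact_mod_cast hn)
  have : (1 : ℝ) ≤ ‖p.coeff n‖ ^ (1 / ((p.natDegree : ℝ) - n)) :=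
    Real.one_le_rpow (not_lt.mp hc) hpos.le
  linarith

end SpectralValue

/-! ### Integers and the canonical prime of `F̄` via the spectral norm -/

section Spectral

variable {F : Type*} [NontriviallyNormedField F] [IsUltrametricDist F] [CompleteSpace F]
  {Γ : Type*} [LinearOrderedCommGroupWithZero Γ] {w : Valuation F Γ}

omit [IsUltrametricDist F] [CompleteSpace F] in
/-- If a valuation `w` and an absolute value `‖·‖` on a field have the same closed unit ball,
they have the same open unit ball (apply the hypothesis to `x⁻¹`). [folklore] -/
theorem valuation_lt_one_iff_norm_lt_one_of_le (hw : ∀ x : F, w x ≤ 1 ↔ ‖x‖ ≤ 1) (x : F) :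
    w x < 1 ↔ ‖x‖ < 1 := by
  rcases eq_or_ne x 0 with rfl | hx
  · simp
  · have h := hw x⁻¹
    rw [map_inv₀, norm_inv, inv_le_one₀ ((Valuation.pos_iff w).mpr hx),
      inv_le_one₀ (norm_pos_iff.mpr hx)] at h
    rw [← not_le, h, not_le]

variable (hw : ∀ x : F, w x ≤ 1 ↔ ‖x‖ ≤ 1)
include hw

omit [IsUltrametricDist F] [CompleteSpace F] in
/-- **The integers of `F̄` are the closed unit ball of the spectral norm**: for `w` a valuation on
the complete field `F` with `w x ≤ 1 ↔ ‖x‖ ≤ 1`, an element of `F̄` is integral over `w.integer`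
iff its spectral norm is `≤ 1` (iff its minimal polynomial over `F` has coefficients in
`w.integer`).
Ref: Serre, *Local Fields*, Ch. II §2, Prop. 3 (the integral closure of the valuation ring is the
valuation ring of the prolonged valuation). [cite: SerreLocalFields1979, Ch. II §2 Prop. 3] -/
theorem mem_absIntegers_integer_iff_spectralNorm_le_one (x : AlgebraicClosure F) :
    x ∈ absIntegers w.integer F ↔ spectralNorm F (AlgebraicClosure F) x ≤ 1 := by
  have hxint : IsIntegral F x := Algebra.IsIntegral.isIntegral x
  rw [absIntegers, mem_integralClosure_iff]
  constructor
  · intro hx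
    rw [spectralNorm, minpoly.isIntegrallyClosed_eq_field_fractions' F hx,
      spectralValue_le_one_iff ((minpoly.monic hx).map _)]
    intro n
    rw [Polynomial.coeff_map]
    exact (hw _).mp ((minpoly w.integer x).coeff n).2
  · intro hx
    rw [spectralNorm, spectralValue_le_one_iff (minpoly.monic hxint)] at hx
    have hlifts : minpoly F x ∈ Polynomial.lifts (algebraMap w.integer F) := by
      rw [Polynomial.lifts_iff_coeff_lifts]
      intro n
      exact ⟨⟨(minpoly F x).coeff n, (hw _).mpr (hx n)⟩, rfl⟩
    obtain ⟨q, hq, -, hqm⟩ :=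
      Polynomial.lifts_and_natDegree_eq_and_monic hlifts (minpoly.monic hxint)
    refine ⟨q, hqm, ?_⟩
    have : Polynomial.aeval x (q.map (algebraMap w.integer F)) = 0 := by
      rw [hq, minpoly.aeval]
    rwa [Polynomial.aeval_map_algebraMap, Polynomial.aeval_def] at this

omit [IsUltrametricDist F] [CompleteSpace F] in
/-- The image in `F̄` of an element of the maximal ideal of `w.integer` has spectral norm `< 1`
(the spectral norm extends `‖·‖`, Mathlib `spectralNorm_extends`). [folklore] -/
theorem spectralNorm_algebraMap_lt_one {c : w.integer}
    (hc : c ∈ IsLocalRing.maximalIdeal w.integer) :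
    spectralNorm F (AlgebraicClosure F) (algebraMap w.integer (AlgebraicClosure F) c) < 1 := by
  rw [IsScalarTower.algebraMap_apply w.integer F (AlgebraicClosure F), spectralNorm_extends,
    ← valuation_lt_one_iff_norm_lt_one_of_le hw]
  rw [IsLocalRing.mem_maximalIdeal, mem_nonunits_iff,
    Valuation.Integer.not_isUnit_iff_valuation_lt_one] at hc
  exact hc

/-- **The canonical prime `𝔓 = (𝓂_w S).radical` of `S = absIntegers w.integer F` is the open unit
ball of the spectral norm**: `x ∈ 𝔓 ↔ |x|_sp < 1`.  (`⊆`: the open unit ball is a radical ideal of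
`S` containing the generators of `𝓂_w S`; `⊇`: if `|x|_sp < 1` the non-leading coefficients of the
minimal polynomial of `x`, which lie in `w.integer`, have norm `< 1`, so `x ^ n ∈ 𝓂_w S`.)
Ref: Serre, *Local Fields*, Ch. II §2, Prop. 3 and Cor. 2 (the prolonged valuation is unique and
its ring is the integral closure; its maximal ideal is the unique prime over `𝓂`).
[cite: SerreLocalFields1979, Ch. II §2 Prop. 3 and Cor. 2] -/
theorem mem_radical_map_maximalIdeal_iff (x : absIntegers w.integer F) :
    x ∈ ((IsLocalRing.maximalIdeal w.integer).map
        (algebraMap w.integer (absIntegers w.integer F))).radical ↔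
      spectralNorm F (AlgebraicClosure F) x < 1 := by
  -- the open unit ball as an ideal of `S`
  let J : Ideal (absIntegers w.integer F) :=
    { carrier := {x | spectralNorm F (AlgebraicClosure F) x < 1}
      add_mem' := fun {a b} ha hb => by
        refine lt_of_le_of_lt ?_ (max_lt (show spectralNorm F (AlgebraicClosure F) a < 1 from ha)
          (show spectralNorm F (AlgebraicClosure F) b < 1 from hb))
        simpa only [Subalgebra.coe_add] using
          isNonarchimedean_spectralNorm (a : AlgebraicClosure F) (b : AlgebraicClosure F)
      zero_mem' := by
        change spectralNorm F (AlgebraicClosure F)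
          ((0 : absIntegers w.integer F) : AlgebraicClosure F) < 1
        rw [ZeroMemClass.coe_zero, spectralNorm_zero]
        exact zero_lt_one
      smul_mem' := fun c {a} ha => by
        change spectralNorm F (AlgebraicClosure F)
          ((c * a : absIntegers w.integer F) : AlgebraicClosure F) < 1
        rw [Subalgebra.coe_mul, ← spectralMulAlgNorm_def, map_mul, spectralMulAlgNorm_def,
          spectralMulAlgNorm_def]
        exact mul_lt_one_of_nonneg_of_lt_one_right
          ((mem_absIntegers_integer_iff_spectralNorm_le_one hw (c : AlgebraicClosure F)).mp c.2)
          (spectralNorm_nonneg _) ha }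
  have hJ : ∀ y : absIntegers w.integer F, y ∈ J ↔ spectralNorm F (AlgebraicClosure F) y < 1 :=
    fun y => Iff.rfl
  have hJrad : J.IsRadical := by
    intro y ⟨n, hn⟩
    rw [hJ] at hn ⊢
    rcases Nat.eq_zero_or_pos n with rfl | hnpos
    · rw [pow_zero, OneMemClass.coe_one, spectralNorm_one] at hn
      exact absurd hn (lt_irrefl _)
    · rw [Subalgebra.coe_pow, isPowMul_spectralNorm (y : AlgebraicClosure F) hnpos] at hn
      exact (pow_lt_one_iff_of_nonneg (spectralNorm_nonneg _) hnpos.ne').mp hn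
  have hmapJ : (IsLocalRing.maximalIdeal w.integer).map
      (algebraMap w.integer (absIntegers w.integer F)) ≤ J := by
    rw [Ideal.map_le_iff_le_comap]
    intro c hc
    rw [Ideal.mem_comap, hJ]
    have : ((algebraMap w.integer (absIntegers w.integer F) c : absIntegers w.integer F) :
        AlgebraicClosure F) = algebraMap w.integer (AlgebraicClosure F) c := rfl
    rw [this]
    exact spectralNorm_algebraMap_lt_one hw hc
  constructor
  · intro hx
    exact (hJ x).mp ((hJrad.radical_le_iff.mpr hmapJ) hx)
  · intro hx
    -- `x` is integral over `w.integer`; its minimal polynomial has lower coefficients in `𝓂_w`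
    have hxO : IsIntegral w.integer (x : AlgebraicClosure F) := x.2
    have hxS : IsIntegral w.integer x := Algebra.IsIntegral.isIntegral x
    set q : (w.integer)[X] := minpoly w.integer x with hq
    have hqm : q.Monic := minpoly.monic hxS
    have hqL : minpoly w.integer (x : AlgebraicClosure F) = q := by
      rw [hq]
      exact minpoly.algebraMap_eq
        (FaithfulSMul.algebraMap_injective (absIntegers w.integer F) (AlgebraicClosure F)) x
    have hminF : minpoly F (x : AlgebraicClosure F) = q.map (algebraMap w.integer F) := by
      rw [minpoly.isIntegrallyClosed_eq_field_fractions' F hxO, hqL]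
    have hdeg : (minpoly F (x : AlgebraicClosure F)).natDegree = q.natDegree := by
      rw [hminF, hqm.natDegree_map]
    have hcoeff : ∀ n < q.natDegree, q.coeff n ∈ IsLocalRing.maximalIdeal w.integer := by
      intro n hn
      rw [IsLocalRing.mem_maximalIdeal, mem_nonunits_iff,
        Valuation.Integer.not_isUnit_iff_valuation_lt_one,
        valuation_lt_one_iff_norm_lt_one_of_le hw]
      have h1 : ‖(minpoly F (x : AlgebraicClosure F)).coeff n‖ < 1 :=
        norm_coeff_lt_one_of_spectralValue_lt_one hx (hdeg ▸ hn)
      rwa [hminF, Polynomial.coeff_map] at h1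
    -- `x ^ deg q = -(lower terms) ∈ 𝓂_w S`
    refine ⟨q.natDegree, ?_⟩
    have h0 : Polynomial.aeval x q = 0 := minpoly.aeval w.integer x
    rw [hqm.as_sum, map_add, map_pow, Polynomial.aeval_X, map_sum] at h0
    rw [eq_neg_of_add_eq_zero_left h0]
    refine (Ideal.neg_mem_iff _).mpr (Ideal.sum_mem _ fun i hi => ?_)
    rw [map_mul, map_pow, Polynomial.aeval_X, Polynomial.aeval_C]
    exact Ideal.mul_mem_right _ _ (Ideal.mem_map_of_mem _ (hcoeff i (Finset.mem_range.mp hi)))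

/-- The canonical prime `𝔓 = (𝓂_w S).radical` is a **maximal** ideal of `S` (an element of
`S ∖ 𝔓` has spectral norm `1`, hence is a unit of `S`).
Ref: Serre, *Local Fields*, Ch. II §2, Prop. 3. [cite: SerreLocalFields1979, Ch. II §2 Prop. 3] -/
theorem isMaximal_radical_map_maximalIdeal :
    ((IsLocalRing.maximalIdeal w.integer).map
        (algebraMap w.integer (absIntegers w.integer F))).radical.IsMaximal := by
  rw [Ideal.isMaximal_iff]
  constructor
  · rw [mem_radical_map_maximalIdeal_iff hw, OneMemClass.coe_one, spectralNorm_one]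
    exact lt_irrefl _
  · intro J x hPJ hxP hxJ
    rw [mem_radical_map_maximalIdeal_iff hw, not_lt] at hxP
    have hx1 : spectralNorm F (AlgebraicClosure F) x = 1 :=
      le_antisymm
        ((mem_absIntegers_integer_iff_spectralNorm_le_one hw (x : AlgebraicClosure F)).mp x.2) hxP
    have hx0 : (x : AlgebraicClosure F) ≠ 0 := by
      intro h
      rw [h, spectralNorm_zero] at hx1
      exact zero_ne_one hx1
    have hinv1 : spectralNorm F (AlgebraicClosure F) (x : AlgebraicClosure F)⁻¹ = 1 := by
      have h := congrArg (spectralNorm F (AlgebraicClosure F)) (mul_inv_cancel₀ hx0)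
      rwa [← spectralMulAlgNorm_def, map_mul, spectralMulAlgNorm_def, spectralMulAlgNorm_def, hx1,
        one_mul, spectralNorm_one] at h
    have hinv : (x : AlgebraicClosure F)⁻¹ ∈ (absIntegers w.integer F) := by
      rw [mem_absIntegers_integer_iff_spectralNorm_le_one hw, hinv1]
    have hunit : IsUnit x :=
      ⟨⟨x, ⟨_, hinv⟩, Subtype.ext (mul_inv_cancel₀ hx0), Subtype.ext (inv_mul_cancel₀ hx0)⟩, rfl⟩
    rw [J.eq_top_of_isUnit_mem hxJ hunit]
    trivial

/-- The canonical prime `𝔓` is stable under `Gal(F̄/F)` (isometries preserve the open unit ball).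
Ref: Serre, *Local Fields*, Ch. II §2, Cor. 2–3 to Prop. 3.
[cite: SerreLocalFields1979, Ch. II §2 Cor. 2–3] -/
theorem smul_radical_map_maximalIdeal (σ : absoluteGaloisGroup F) :
    σ • ((IsLocalRing.maximalIdeal w.integer).map
        (algebraMap w.integer (absIntegers w.integer F))).radical =
      ((IsLocalRing.maximalIdeal w.integer).map
        (algebraMap w.integer (absIntegers w.integer F))).radical := by
  ext x
  rw [Ideal.mem_pointwise_smul_iff_inv_smul_mem, mem_radical_map_maximalIdeal_iff hw,
    mem_radical_map_maximalIdeal_iff hw, integralClosure.coe_smul,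
    spectralNorm_absoluteGaloisGroup_smul]

/-- The canonical prime `𝔓` lies over the maximal ideal of `w.integer`: `𝔓 ∩ w.integer = 𝓂_w`
(the spectral norm extends `‖·‖`).
Ref: Serre, *Local Fields*, Ch. II §2, Prop. 3. [cite: SerreLocalFields1979, Ch. II §2 Prop. 3] -/
theorem under_radical_map_maximalIdeal :
    ((IsLocalRing.maximalIdeal w.integer).map
        (algebraMap w.integer (absIntegers w.integer F))).radical.under w.integer =
      IsLocalRing.maximalIdeal w.integer := by
  ext c
  rw [Ideal.under_def, Ideal.mem_comap, mem_radical_map_maximalIdeal_iff hw,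
    IsLocalRing.mem_maximalIdeal, mem_nonunits_iff,
    Valuation.Integer.not_isUnit_iff_valuation_lt_one, valuation_lt_one_iff_norm_lt_one_of_le hw]
  have : ((algebraMap w.integer (absIntegers w.integer F) c : absIntegers w.integer F) :
      AlgebraicClosure F) = algebraMap F (AlgebraicClosure F) c := rfl
  rw [this, spectralNorm_extends]

/-- The canonical prime `𝔓` is the **unique** prime of `S` over `𝓂_w` (a prime over `𝓂_w`
contains `𝓂_w S`, hence its radical `𝔓`, which is maximal).
Ref: Serre, *Local Fields*, Ch. II §2, Cor. 2 to Prop. 3 (uniqueness of the prolongation).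
[cite: SerreLocalFields1979, Ch. II §2 Cor. 2] -/
theorem primesOver_maximalIdeal_eq_singleton_radical :
    (IsLocalRing.maximalIdeal w.integer).primesOver (absIntegers w.integer F) =
      {((IsLocalRing.maximalIdeal w.integer).map
        (algebraMap w.integer (absIntegers w.integer F))).radical} := by
  ext Q
  simp only [Set.mem_singleton_iff]
  constructor
  · rintro ⟨hQ, hQover⟩
    have hle : ((IsLocalRing.maximalIdeal w.integer).map
        (algebraMap w.integer (absIntegers w.integer F))).radical ≤ Q := by
      rw [hQ.isRadical.radical_le_iff, Ideal.map_le_iff_le_comap, ← Ideal.under_def, ← hQover.over]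
    exact ((isMaximal_radical_map_maximalIdeal hw).eq_of_le hQ.ne_top hle).symm
  · rintro rfl
    exact ⟨(isMaximal_radical_map_maximalIdeal hw).isPrime,
      ⟨(under_radical_map_maximalIdeal hw).symm⟩⟩

end Spectral

end Literature.NumberTheory.GaloisRepresentations

/-! ### Discharges of the two henselian named facts of `LocalGaloisGroup.lean` -/

namespace Literature.NumberTheory.GaloisRepresentations

open ValuativeRel GaloisRepresentations.IsNonarchimedeanLocalField

section LocalField

variable (F : Type*) [Field F] [ValuativeRel F] [TopologicalSpace F] [IsNonarchimedeanLocalField F]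

/-- The two henselian facts about `𝔓 = absMaximalIdeal F` at once: `𝔓` is maximal and it is the
only prime of `absIntegers 𝒪[F] F` over `𝓂[F]`.  (The rank-one normed field structure of `F`
attached to `valuation F` is constructed inside the proof exactly as in Mathlib's
`Mathlib/NumberTheory/LocalField/Basic.lean`; `F` is complete, and the results of section
`Spectral` are applied to `w = valuation F`.)
Ref: Serre, *Local Fields*, Ch. II §2, Prop. 3 and Cor. 2.
[cite: SerreLocalFields1979, Ch. II §2 Prop. 3, Cor. 2] -/
theorem absMaximalIdeal_isMaximal_and_primesOver_eq :
    (absMaximalIdeal F).IsMaximal ∧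
      (𝓂[F]).primesOver (absIntegers 𝒪[F] F) = {absMaximalIdeal F} := by
  letI := IsTopologicalAddGroup.rightUniformSpace F
  haveI := isUniformAddGroup_of_addCommGroup (G := F)
  letI hv : (Valued.v (R := F)).RankOne :=
  { hom' := IsRankLeOne.nonempty.some.emb (R := F) |>.comp MonoidWithZeroHom.ValueGroup₀.embedding
    strictMono' := IsRankLeOne.nonempty.some.strictMono.comp
        MonoidWithZeroHom.ValueGroup₀.embedding_strictMono }
  letI := Valued.toNontriviallyNormedField F (ValueGroupWithZero F)
  have hw : ∀ x : F, valuation F x ≤ 1 ↔ ‖x‖ ≤ 1 := fun x =>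
    (Valued.toNormedField.norm_le_one_iff (L := F) (Γ₀ := ValueGroupWithZero F)).symm
  exact ⟨isMaximal_radical_map_maximalIdeal hw, primesOver_maximalIdeal_eq_singleton_radical hw⟩

/-- **Discharge of `IsNonarchimedeanLocalField.absMaximalIdeal_isMaximal`**: `𝔓 = absMaximalIdeal F`
is a maximal ideal of `absIntegers 𝒪[F] F` (henselianity of the complete field `F`: the integral
closure of `𝒪[F]` in `F̄` is the valuation ring of the spectral norm, a local ring whose maximal
ideal is the open unit ball `𝔓`).
Ref: Serre, *Local Fields*, Ch. II §2, Prop. 3; Neukirch, *Algebraic Number Theory*, Ch. II (6.2).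
[cite: SerreLocalFields1979, Ch. II §2 Prop. 3] [cite: NeukirchANT1999, Ch. II (6.2)] -/
theorem IsNonarchimedeanLocalField.absMaximalIdeal_isMaximal_holds : absMaximalIdeal_isMaximal F :=
  (absMaximalIdeal_isMaximal_and_primesOver_eq F).1

/-- **Discharge of `IsNonarchimedeanLocalField.primesOver_maximalIdeal_eq_singleton`**: `𝔓` is the
unique prime of `absIntegers 𝒪[F] F` over `𝓂[F]` (uniqueness of the prolongation of the valuation
of the complete field `F`).
Ref: Serre, *Local Fields*, Ch. II §2, Cor. 2 to Prop. 3; Neukirch, *Algebraic Number Theory*,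
Ch. II (6.2), (8.1). [cite: SerreLocalFields1979, Ch. II §2 Cor. 2] -/
theorem IsNonarchimedeanLocalField.primesOver_maximalIdeal_eq_singleton_holds :
    primesOver_maximalIdeal_eq_singleton F :=
  (absMaximalIdeal_isMaximal_and_primesOver_eq F).2

end LocalField

end Literature.NumberTheory.GaloisRepresentations
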